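import Summits.QuantumFields.BalabanUV.T4Continuum.Support.NE7CovDivGeneralDatum
import Summits.QuantumFields.BalabanUV.T4Continuum.Support.NE7RoutePiRegimeSU2
import Summits.QuantumFields.BalabanUV.T4Continuum.Support.NE7ConvOneStepSU2
import Summits.QuantumFields.BalabanUV.T4Continuum.Support.SmoothRefineAbelianFlux
import Summits.QuantumFields.BalabanUV.T4Continuum.Support.NE7LatticeLandauMinimiser
import HarnessLib

/-!
# NE7 — THE CURRENT OF OUR TANGENT-CRITICAL CONFIGURATIONS IN THE CLASS, `d = 4`, `L = 2`, READ AS ONE `k`-FREE CONSTANT (F301):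
# `‖(D*_U ∂U)(b)‖ = ‖covDiv 1 U ν y‖ ≤ C·r∕M³` at EVERY bond, for every tangent-critical `U ∈ admissible (sfClass 4 2 N ε) 2 (k+1) D` with `SmallField U (r∕M²)`,
# `r ≤ 1∕4`, `0 < ε ≤ 10⁻⁵³` (F296 `NE7CovDivGeneralDatum` with its side conditions discharged, made periodic, and its constant simplified)

Cell `pub-balaban`, rung (B)+1 sub-cell t4, lineage `b2b-balaban-t4-ne7-p1` (CRUX PROVER NE7 #1 = OWNER of row NE7), generation 92; memo
`t4/b2b-balaban-t4-ne7-p1-g92/LOG-OBSTRUCTION.md` §4 (ROAD (U), the current input of brick (B1)).  Over F296 `NE7CovDivGeneralDatum.norm_covDiv_le_of_tanCritical_gen`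
([B8] (1.9) ∕ [B11] (2)'s current clause for OUR tangent-critical configurations over a general datum), row NE3's `tangentIter_iff_dirIter_eq_zero`, the regime lemmas
`NE7ConvOneStepSU2.levelSmall_all_d4_L2`, `NE7RoutePiRegimeSU2.thetaLoc_mul_lt_one`, and `SmoothRefineAbelianFlux.hol_add_period` (periodicity of (1.2)).

WHY.  F300 `NE7CubeGradientOfLandauSup` turns the sup letter of a local Landau chart into the gradient letter GIVEN the gauge-invariant current `‖covDiv 1 U‖ ≤ j` on the
cube.  For the configurations route 1 quantifies over — tangent-critical admissible `U` of the class — that current IS small, `≲ r∕M³`: this is F296, but F296 speaks on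
the period box, with the class's side letters (`LevelSmall`, `cruxC·ε < 1`, `thetaLoc·ε < 1`) displayed and an explicit exponential constant.  This file packages it as
the END consumes it: ONE constant `C` (depending on `card n` only), every bond `y ∈ ℤ⁴` (periodicity), hypotheses exactly those available inside F286w∕F298's binders.
WHAT ([folklore]; 0 def, 0 sorry).  §1 `covDiv_add_period'`, `covDiv_cmod` (periodicity of (1.2) for periodic `U`; universe-polymorphic restatement of lineage #2's
service lemma).  §2 `geom_identity` (`M⁴∕M²·(2∕2⁴)^{k+1} = M⁻¹`).  §3 **`exists_classCurrentConst`**: `∃ C ≥ 0` ∀ `N ≥ 1`, `0 < ε ≤ 10⁻⁵³`, `D`, `k`, tangent-critical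
`U ∈ admissible (sfClass 4 2 N ε) 2 (k+1) D`, `0 ≤ r ≤ 1∕4` with `SmallField U (r∕M²)`: `‖covDiv 1 U ν y‖ ≤ C·r∕M³` for all `ν`, `y`.
HONEST FRAMING (page 1): a repackaging of F296 (itself elementary lattice analysis of OUR objects at a tangent-critical configuration); tangent-criticality is a HYPOTHESIS on
`U`; nothing of Bałaban's asserted; NE7 NOT PROVED; spine 0∕9; finite T⁴ rung (B)+1 — NOT infinite volume, NOT mass gap, NOT `BetaPertH`, NOT Clay.  Continuum YM on T⁴ ⇐
BetaPertH ∧ nine spine estimates (0/9 proved); BetaPertH ⇐ (D1) ∧ (D4) ∧ CAP+tail; G-an2-4 gates asym, D1 and NE2/3/4.  No `sorry`; axioms ⊆ {propext, Classical.choice,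
Quot.sound}.
-/

set_option autoImplicit false

open scoped BigOperators Matrix.Norms.L2Operator
open NormedSpace Finset

namespace Summit.QuantumFields.BalabanUV.T4Continuum.NE7ClassCurrentBound

open Literature.MathematicalPhysics.QuantumFieldTheory.Balaban1983to89
open B7Prop1Explicit B7Prop2Explicit
open B8Ineq132 (covDiv norm_covDiv_gaugeAct)
open T4AveragingDeficitWall (IsUnitaryCfg IsSkewDir SmallField)
open T4AveragingDeficitWallBoundary (IsPeriodicCfg periodBox)
open AveragingDeficitPeriodicCounting (IsPeriodicDir)
open AveragingDeficitMultiLevelPrep (LevelSmall TangentIter)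
open AveragingDeficitTransport (mem_U1_of_unitary)
open AveragingDeficitTorusChart (periodic_smul_vec)
open BlockAverageVaryHolo (nbRad)
open AveragingDeficitTwoLevelPrep (twoLevelSmall)
open MinimalActionLevels (perWin)
open MinimalActionSandwich (admissible)
open MinimalActionRate (sfClass)
open NE3HessForm (dAction)
open NE3TangentCovariantTower (dirIter tangentIter_iff_dirIter_eq_zero)
open NE3QbarIterCovLiftPrep (cruxC)
open NE3RightInverseSolveLetters (thetaLoc cruxC_le_thetaLoc cruxC_nonneg)
open NE3HatInvCurlLetters (curl1C curl1C_nonneg)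
open NE7ConvOneStepSU2 (levelSmall_all_d4_L2)
open NE7RoutePiRegimeSU2 (thetaLoc_mul_lt_one thetaLoc_4_2_lt)
open NE7CovDivGeneralDatum (norm_covDiv_le_of_tanCritical_gen)
open SmoothRefineAbelianFlux (hol_add_period)
open SkeletonLattice (cmod cdiv smul_cdiv_add_cmod)
open NE7LatticeLandauMinimiser (cmod_mem_periodBox)

noncomputable section

variable {n : Type*} [Fintype n] [DecidableEq n]

/-! ## §1 Periodicity of the covariant divergence (1.2) -/

/-- For a `P`-periodic configuration the covariant divergence (1.2) is `P`-periodic in each lattice direction. [folklore] -/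
theorem covDiv_add_period' {d : ℕ} {U : Site d → Fin d → (Matrix n n ℂ)ˣ} {P : ℤ} (hUP : IsPeriodicCfg U P) (η : ℝ) (ν : Fin d) (y : Site d) (i : Fin d) :
    covDiv η U ν (y + P • e i) = covDiv η U ν y := by
  unfold covDiv B8Ineq132.covDeriv B8Ineq132.plaqF
  have h1 : ∀ μ : Fin d, y + P • e i - e μ = (y - e μ) + P • e i := fun μ => by abel
  have hU' : ∀ (x : Site d) (μ : Fin d), U (x + P • e i) μ = U x μ := fun x μ => hUP x i μ
  simp only [h1, hol_add_period U hUP, hU']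

/-- Hence `covDiv η U ν y = covDiv η U ν (cmod P y)`, and `cmod P y` lies in the period box. [folklore] -/
theorem covDiv_cmod {d : ℕ} {U : Site d → Fin d → (Matrix n n ℂ)ˣ} {P : ℕ} (hUP : IsPeriodicCfg U (P : ℤ)) (η : ℝ) (ν : Fin d) (y : Site d) :
    covDiv η U ν y = covDiv η U ν (cmod P y) := by
  have h1 : y = cmod P y + (P : ℤ) • cdiv P y := by rw [add_comm]; exact (smul_cdiv_add_cmod P y).symm
  conv_lhs => rw [h1]
  exact periodic_smul_vec (f := fun w => covDiv η U ν w) (N := (P : ℤ)) (fun w i => covDiv_add_period' hUP η ν w i) (cmod P y) (cdiv P y)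

/-! ## §2 The geometric identity of the letters -/

/-- `M⁴∕M²·(2∕2⁴)^{k+1} = 1∕M` for `M = 2^{k+1}`. [folklore] -/
theorem geom_identity (k : ℕ) :
    (((2 : ℕ) : ℝ) ^ (k + 1)) ^ 4 / (((2 : ℕ) : ℝ) ^ (k + 1)) ^ 2 * ((((2 : ℕ) : ℝ)) / ((2 : ℕ) : ℝ) ^ 4) ^ (k + 1) = 1 / ((2 : ℕ) : ℝ) ^ (k + 1) := by
  have hM : (0 : ℝ) < ((2 : ℕ) : ℝ) ^ (k + 1) := by positivity
  have h16 : (((2 : ℕ) : ℝ) ^ 4) ^ (k + 1) = (((2 : ℕ) : ℝ) ^ (k + 1)) ^ 4 := by rw [← pow_mul, ← pow_mul, mul_comm]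
  rw [div_pow, h16]
  field_simp

/-! ## §3 The class current bound -/

set_option maxHeartbeats 800000 in
/-- **THE CURRENT OF OUR TANGENT-CRITICAL CONFIGURATIONS, ONE CONSTANT.**  There is `C ≥ 0` (depending on `card n` only) such that for every `N ≥ 1`, `0 < ε ≤ 10⁻⁵³`,
datum `D`, level `k`, every `U ∈ admissible (sfClass 4 2 N ε) 2 (k+1) D` that is tangent-critical (`dAction U φ = 0` on the skew periodic `φ` tangent to the fibre), and
every `0 ≤ r ≤ 1∕4` with `SmallField U (r∕M²)` (`M = 2^{k+1}`): `‖covDiv 1 U ν y‖ ≤ C·r∕M³` at every site `y` and component `ν` ([B8] (1.2) at `η = 1`; F296 with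
`LevelSmall`, `cruxC·ε < 1`, `thetaLoc·ε < 1` discharged in the regime, periodicity, and `M⁴∕M²·(2∕16)^{k+1} = M⁻¹`). [folklore] -/
theorem exists_classCurrentConst [Nonempty n] :
    ∃ C : ℝ, 0 ≤ C ∧ ∀ (N : ℕ) [NeZero N] (ε : ℝ), 0 < ε → ε ≤ 1 / 10 ^ 53 →
      ∀ (D : Site 4 → Fin 4 → (Matrix n n ℂ)ˣ) (k : ℕ), ∀ U ∈ admissible (sfClass 4 2 N ε) 2 (k + 1) D,
      (∀ φ : Site 4 → Fin 4 → Matrix n n ℂ, IsSkewDir φ → IsPeriodicDir φ ((N * 2 ^ (k + 1) : ℕ) : ℤ) → TangentIter 2 k U φ →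
        dAction U φ (perWin 4 (N * 2 ^ (k + 1))) = 0) →
      ∀ r : ℝ, 0 ≤ r → r ≤ 1 / 4 → SmallField U (r / (((2 : ℕ) : ℝ) ^ (k + 1)) ^ 2) →
      ∀ (ν : Fin 4) (y : Site 4), ‖covDiv 1 U ν y‖ ≤ C * r / (((2 : ℕ) : ℝ) ^ (k + 1)) ^ 3 := by
  -- the exponential constant of F296 at `d = 4`, `L = 2`
  set E : ℝ := Real.exp ((((2 : ℕ) : ℝ) ^ 4 / ((2 : ℕ) : ℝ)) * (((4 : ℕ) : ℝ) * (16 * (((4 : ℕ) : ℝ) + 1) * (((4 : ℕ) : ℝ) + 4) * ((2 : ℕ) : ℝ) ^ 2)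
      * (1250 * ((nbRad 4 2 : ℝ) + ((2 : ℕ) : ℝ)) + 8 * (((4 : ℕ) : ℝ) * ((2 : ℕ) : ℝ)) + 2 * ((2 : ℕ) : ℝ))) * (2 / twoLevelSmall 4 2)) with hE
  have hE0 : 0 ≤ E := (Real.exp_pos _).le
  refine ⟨(Fintype.card n : ℝ) * (2 * curl1C 4 2 * E) + (12 * (Fintype.card (T4AveragingDeficitWall.Plane 4) : ℝ) * (Fintype.card n : ℝ) + 32) / 4,
    by have := curl1C_nonneg 4 2; positivity, ?_⟩
  intro N _ ε hε hε' D k U hU hcrit r hr0 hr4 hUr ν y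
  -- names
  have hM0 : (0 : ℝ) < ((2 : ℕ) : ℝ) ^ (k + 1) := by positivity
  have hM1 : (1 : ℝ) ≤ ((2 : ℕ) : ℝ) ^ (k + 1) := one_le_pow₀ (by norm_num)
  set M : ℝ := ((2 : ℕ) : ℝ) ^ (k + 1) with hMdef
  -- class data
  have hUu : IsUnitaryCfg U := hU.1.1
  have hUP : IsPeriodicCfg U ((N * 2 ^ (k + 1) : ℕ) : ℤ) := hU.1.2.1
  have hUx : SmallField U (ε / M ^ 2) := hU.1.2.2
  have hx : 0 ≤ ε / M ^ 2 := by positivity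
  have hs : LevelSmall 4 2 k (ε / M ^ 2) := levelSmall_all_d4_L2 hε.le (hε'.trans (by norm_num)) k
  have hMx : M ^ 2 * (ε / M ^ 2) = ε := by field_simp
  have hθl : thetaLoc 4 2 * (M ^ 2 * (ε / M ^ 2)) < 1 := by rw [hMx]; exact thetaLoc_mul_lt_one hε hε'
  have hθ : cruxC 4 2 * (M ^ 2 * (ε / M ^ 2)) < 1 := by
    rw [hMx]; exact lt_of_le_of_lt (mul_le_mul_of_nonneg_right (cruxC_le_thetaLoc 4 2) hε.le) (thetaLoc_mul_lt_one hε hε')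
  have hε1 : M ^ 2 * (ε / M ^ 2) ≤ 1 := by rw [hMx]; exact hε'.trans (by norm_num)
  have ha4 : r / M ^ 2 ≤ 1 / 4 := by
    rw [div_le_iff₀ (by positivity)]
    nlinarith [one_le_pow₀ (M₀ := ℝ) (a := M) hM1 (n := 2)]
  have hcrit' : ∀ Y' : Site 4 → Fin 4 → Matrix n n ℂ, IsSkewDir Y' → IsPeriodicDir Y' ((N * 2 ^ (k + 1) : ℕ) : ℤ) →
      dirIter 2 (k + 1) U Y' = 0 → dAction U Y' (perWin 4 (N * 2 ^ (k + 1))) = 0 :=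
    fun Y' h1 h2 h3 => hcrit Y' h1 h2 ((tangentIter_iff_dirIter_eq_zero 2 k U Y').2 h3)
  have hu1 : ∀ x : Site 4, (fun _ : Site 4 => (1 : (Matrix n n ℂ)ˣ)) x ∈ unitaryUnits (Matrix n n ℂ) := fun _ => (unitaryUnits _).one_mem
  -- reduction to the period box
  have hP1 : 1 ≤ N * 2 ^ (k + 1) := Nat.one_le_iff_ne_zero.mpr (mul_ne_zero (NeZero.ne N) (by positivity))
  have hy₀ : cmod (N * 2 ^ (k + 1)) y ∈ periodBox (d := 4) (N * 2 ^ (k + 1)) := cmod_mem_periodBox hP1 y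
  rw [covDiv_cmod hUP 1 ν y]
  -- F296 at the representative
  have h := norm_covDiv_le_of_tanCritical_gen (d := 4) (n := n) (L := 2) (by norm_num) k (N := N) hUu hUP hx hs hUx hθ hθl hε1 (by positivity) ha4 hUr
    hcrit' hu1 (η := (1 : ℝ)) one_ne_zero hy₀ ν
  rw [norm_covDiv_gaugeAct 1 (fun w => mem_U1_of_unitary (hu1 w)) U ν, ← hE, ← hMdef] at h
  refine h.trans ?_
  -- the constant
  rw [hMx, abs_one, inv_one, one_mul]
  have hgeom : M ^ 4 / M ^ 2 * ((((2 : ℕ) : ℝ)) / ((2 : ℕ) : ℝ) ^ 4) ^ (k + 1) = 1 / M := by rw [hMdef]; exact geom_identity k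
  have hθε : 1 - thetaLoc 4 2 * ε ≥ 1 / 2 := by
    have h0 : 0 ≤ thetaLoc 4 2 := (cruxC_nonneg 4 2).trans (cruxC_le_thetaLoc 4 2)
    have h1 : thetaLoc 4 2 * ε ≤ 10 ^ 19 * (1 / 10 ^ 53) := mul_le_mul thetaLoc_4_2_lt.le hε' hε.le (by norm_num)
    norm_num at h1 ⊢; linarith
  have hc0 := curl1C_nonneg 4 2
  -- main term: `a·(curl1C∕(1−θε))·(M⁴∕M²)·E·(2∕16)^{k+1} = (r∕M²)·(curl1C∕(1−θε))·E∕M ≤ 2·curl1C·E·r∕M³`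
  have hmain : (r / M ^ 2 * ((curl1C 4 2 / (1 - thetaLoc 4 2 * ε)) * (M ^ 4 / M ^ 2))) * E * ((((2 : ℕ) : ℝ)) / ((2 : ℕ) : ℝ) ^ 4) ^ (k + 1)
      ≤ 2 * curl1C 4 2 * E * (r / M ^ 3) := by
    have e1 : (r / M ^ 2 * ((curl1C 4 2 / (1 - thetaLoc 4 2 * ε)) * (M ^ 4 / M ^ 2))) * E * ((((2 : ℕ) : ℝ)) / ((2 : ℕ) : ℝ) ^ 4) ^ (k + 1)
        = (curl1C 4 2 / (1 - thetaLoc 4 2 * ε)) * E * (r / M ^ 2 * (M ^ 4 / M ^ 2 * ((((2 : ℕ) : ℝ)) / ((2 : ℕ) : ℝ) ^ 4) ^ (k + 1))) := by ring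
    rw [e1, hgeom, show r / M ^ 2 * (1 / M) = r / M ^ 3 by rw [div_mul_div_comm, mul_one, ← pow_succ]]
    have h2 : curl1C 4 2 / (1 - thetaLoc 4 2 * ε) ≤ 2 * curl1C 4 2 := by
      rw [div_le_iff₀ (by linarith)]; nlinarith
    have h3 : 0 ≤ r / M ^ 3 := by positivity
    have := mul_le_mul_of_nonneg_right (mul_le_mul_of_nonneg_right h2 hE0) h3
    linarith
  -- the `a²` terms: `a² = r²∕M⁴ ≤ (r∕4)∕M³`
  have ha2 : (r / M ^ 2) ^ 2 ≤ r / 4 / M ^ 3 := by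
    rw [div_pow, div_div, div_le_div_iff₀ (by positivity) (by positivity)]
    have : r ^ 2 ≤ r / 4 * 1 := by nlinarith
    have hM34 : M ^ 3 ≤ (M ^ 2) ^ 2 := by nlinarith [pow_le_pow_right₀ hM1 (show 3 ≤ 4 by norm_num)]
    calc r ^ 2 * (4 * M ^ 3) = 4 * r ^ 2 * M ^ 3 := by ring
      _ ≤ r * M ^ 3 := by nlinarith [pow_pos hM0 3]
      _ ≤ r * (M ^ 2) ^ 2 := by nlinarith
  have hcard : (0 : ℝ) ≤ (Fintype.card n : ℝ) := Nat.cast_nonneg _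
  have hpl : (0 : ℝ) ≤ (Fintype.card (T4AveragingDeficitWall.Plane 4) : ℝ) := Nat.cast_nonneg _
  have hfin : (Fintype.card n : ℝ) * ((r / M ^ 2 * ((curl1C 4 2 / (1 - thetaLoc 4 2 * ε)) * (M ^ 4 / M ^ 2))) * E * ((((2 : ℕ) : ℝ)) / ((2 : ℕ) : ℝ) ^ 4) ^ (k + 1)
        + 12 * (Fintype.card (T4AveragingDeficitWall.Plane 4) : ℝ) * (r / M ^ 2) ^ 2) + 8 * ((4 : ℕ) : ℝ) * (r / M ^ 2) ^ 2
      ≤ ((Fintype.card n : ℝ) * (2 * curl1C 4 2 * E) + (12 * (Fintype.card (T4AveragingDeficitWall.Plane 4) : ℝ) * (Fintype.card n : ℝ) + 32) / 4) * r / M ^ 3 := by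
    have t1 := mul_le_mul_of_nonneg_left (add_le_add hmain (mul_le_mul_of_nonneg_left ha2 (by positivity : (0 : ℝ) ≤ 12 * (Fintype.card (T4AveragingDeficitWall.Plane 4) : ℝ)))) hcard
    have t2 := mul_le_mul_of_nonneg_left ha2 (by norm_num : (0 : ℝ) ≤ 8 * ((4 : ℕ) : ℝ))
    have e : ((Fintype.card n : ℝ) * (2 * curl1C 4 2 * E) + (12 * (Fintype.card (T4AveragingDeficitWall.Plane 4) : ℝ) * (Fintype.card n : ℝ) + 32) / 4) * r / M ^ 3
        = (Fintype.card n : ℝ) * (2 * curl1C 4 2 * E * (r / M ^ 3) + 12 * (Fintype.card (T4AveragingDeficitWall.Plane 4) : ℝ) * (r / 4 / M ^ 3))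
          + 8 * ((4 : ℕ) : ℝ) * (r / 4 / M ^ 3) := by push_cast; ring
    rw [e]; linarith
  linarith [hfin]

end

end Summit.QuantumFields.BalabanUV.T4Continuum.NE7ClassCurrentBound
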